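import Summits.Ventures.LatticeQCDFlow.Scaling.StarSyncCoupling
import Summits.Ventures.LatticeQCDFlow.Scaling.RedrawCycleCoalescence
import Summits.Ventures.LatticeQCDFlow.Scaling.DominatedStarGapAndMixing

/-!
HONEST FRAMING: exact (Metropolis-corrected) sampling algorithms for lattice gauge theory; figures
of merit are autocorrelation/cost numbers at stated couplings and volumes; no continuum-physics
claim.

# StarCycleCertificateLaw — CERTIFICATE ⇒ LAW: FOR THE PERSISTENT HUB WITH ANY NUMBER `K` OF COLD LEVELS, ANY FINITE CONTENT SPACE AND ANY ENTRY BIJECTIONS,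
# A PER-REFRESH-CYCLE CONTRACTION `R·H_n ≤ (1−ρ)·Ψ` OF A POTENTIAL `Ψ ≥ 1{cold levels differ}` UNDER THE SYNCHRONOUS COUPLING GIVES `d(n) ≤ (1−ρ)^k·Ψ_max + x^{−k}(1−h+hx)ⁿ
# ≤ (e·Ψ_max + 1)·e^{−hρn/4}` AND `t_mix(ε) ≤ ⌈(4/(hρ))·log((e·Ψ_max+1)/ε)⌉`, `h = (1−t)w_0` (lean-2 GEN-31, ours)

Venture-side (OURS).  Cell `lqcd-flow` (pub-lqcd), unit `pub-lqcd-lean-2-g31`, 2026-08-29.  Chapter R, file 9 = file 7 (`RedrawCycleCoalescence`, generic) instantiated on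
file 8 (`StarSyncCoupling`, the synchronous coupling `Q` of `t·GSw + (1−t)·Π_w^M` with exact hot redraws).  This is the CONDITIONAL form of OPEN-MATH-chapterM item 1 for
`K ≥ 2`: everything about the chain is discharged here (Markovian coupling, stickiness, the redraw decomposition `Q = h·R + M'`, `R·1{≠} = 1{cold levels differ} ≤ Ψ`,
stationarity of `⊗μ`), and what is taken as a hypothesis is exactly the certificate of `lean-2/MEMO-gen31-coupling-certificate.md`: a potential `Ψ` on pairs with
`0 ≤ Ψ ≤ Ψ_max`, `Ψ ≥ 1` where the cold levels differ, and the row inequality `R·H_n ≤ (1−ρ)·Ψ` for the `n`-truncated cycle sums `H_0 = 0`, `H_{n+1} = h·Ψ + M'·H_n`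
(in words: started just after a shared hot redraw, the expected `Ψ` just before the next one is at most `(1−ρ)·Ψ`).  Hypothesis-equations throughout; no definitions.

## What is proved

* §1 (generic, the free parameters of file 7 chosen): `cyc_bound_le_exp` (`(1−ρ)^k·Ψ_max + x^{−k}(1−h+hx)ⁿ ≤ (e·Ψ_max+1)·e^{−hρn/4}`
  at `k = ⌊nh/4⌋`, `x = 1 − ρ/2`), **`cyc_worstTvDist_le_exp`** (`d(n) ≤ (e·Ψ_max + 1)·e^{−hρn/4}`), `exp_le_of_ge_log`, **`cyc_mixingTime_le`**
  (`t_mix(ε) ≤ ⌈(4/(hρ))·log((e·Ψ_max+1)/ε)⌉₊`) — under the hypotheses of `cyc_worstTvDist_le` and `0 ≤ ρ` (`0 < h`, `0 < ρ` for the mixing time).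
* `starSync_redraw_mulVec_ind_le` — `R·1{≠} ≤ Ψ` for any `Ψ ≥ 0` with `Ψ ≥ 1` where some cold level differs (after a shared redraw the pair differs iff a cold level does).
* **`starCycle_worstTvDist_le_of_certificate`** — the statement of the title: `m ≥ 1`, `0 ≤ t ≤ 1`, `w ≥ 0`, `Σ w = 1`, `μ > 0` normalised, `M_k` row-stochastic and
  `μ_k`-reversible, `M_0(u,·) = μ_0`; certificate `(Ψ, Ψ_max, ρ ≤ 1, H)` as above ⇒ `d(n) ≤ (1−ρ)^k·Ψ_max + x^{−k}·(1 − h + h·x)ⁿ` for all `n, k`, `0 < x ≤ 1`.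
* **`starCycle_mixingTime_le_of_certificate`** — the same certificate with `0 < ρ ≤ 1`, `t < 1`, `w_0 > 0` ⇒ **`t_mix(ε) ≤ ⌈(4/((1−t)w_0·ρ))·log((e·Ψ_max + 1)/ε)⌉₊`**;
  with the memo's `ρ ≍ (p/K)·min{1,t/h}` this is the conjectured `O(K/(p·min{t,h})·log(K/ε))` of item 1.

Reading (no numerics implied): for the candidate `Ψ = (D + ζ·N_bad)·1{D ≥ 1}` (`Ψ_max ≤ (1+ζ)K`) the memo's toy computations give `ρ ≍ (p/K)·min{1,t/h}` for `q = 2`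
(`K ≤ 5`) and `q = 3` (`K = 2,3`); proving that row inequality is what remains of item 1.  NOT CLAIMED: the inequality for any `K ≥ 2`; anything measured.  Literature grade
(cell rule): OWN; LPW Cor. 5.5 through the tree; nothing cited as a fact; no new bib keys.
-/

noncomputable section

open Finset Function Matrix
open Literature.Probability.MarkovChains

namespace Summit.Ventures.LatticeQCDFlow.Scaling

variable {K m : ℕ} {S : Type*} [Fintype S] [DecidableEq S] {μ : Fin (K + 1) → S → ℝ} {M : Fin (K + 1) → S → S → ℝ} {w : Fin (K + 1) → ℝ} {t : ℝ}

section ExpForm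

/-- **THE EXPONENTIAL FORM:** at `k = ⌊n·h/4⌋`, `x = 1 − ρ/2` (`0 ≤ h ≤ 1`, `0 ≤ ρ ≤ 1`, `0 ≤ Ψ_max`),
`(1−ρ)^k·Ψ_max + x^{−k}·(1−h+h·x)ⁿ ≤ (e·Ψ_max + 1)·exp(−(hρ/4)·n)`. [ours] -/
theorem cyc_bound_le_exp {h ρ Ψmax : ℝ} (hh0 : 0 ≤ h) (hh1 : h ≤ 1) (hρ0 : 0 ≤ ρ) (hρ1 : ρ ≤ 1) (hΨ : 0 ≤ Ψmax) (n : ℕ) :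
    (1 - ρ) ^ ⌊(n : ℝ) * h / 4⌋₊ * Ψmax + ((1 - ρ / 2) ^ ⌊(n : ℝ) * h / 4⌋₊)⁻¹ * (1 - h + h * (1 - ρ / 2)) ^ n
      ≤ (Real.exp 1 * Ψmax + 1) * Real.exp (-(h * ρ / 4) * n) := by
  set k : ℕ := ⌊(n : ℝ) * h / 4⌋₊ with hk
  have hq0 : 0 ≤ (n : ℝ) * h / 4 := by positivity
  have hk1 : (k : ℝ) ≤ (n : ℝ) * h / 4 := Nat.floor_le hq0
  have hk2 : (n : ℝ) * h / 4 < (k : ℝ) + 1 := Nat.lt_floor_add_one _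
  have hpow1 : (1 - ρ) ^ k ≤ Real.exp (-ρ * k) := by
    have h1 : 1 - ρ ≤ Real.exp (-ρ) := by have := Real.add_one_le_exp (-ρ); linarith
    calc (1 - ρ) ^ k ≤ (Real.exp (-ρ)) ^ k := pow_le_pow_left₀ (by linarith) h1 k
      _ = Real.exp (-ρ * k) := by rw [← Real.exp_nat_mul]; ring_nf
  have hpow2 : ((1 - ρ / 2) ^ k)⁻¹ ≤ Real.exp (ρ * k) := by
    have hx0 : 0 < 1 - ρ / 2 := by linarith
    have h1 : (1 - ρ / 2)⁻¹ ≤ Real.exp ρ := by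
      rw [inv_le_iff_one_le_mul₀ hx0]
      have h2 := Real.add_one_le_exp ρ
      nlinarith [Real.exp_pos ρ, h2]
    calc ((1 - ρ / 2) ^ k)⁻¹ = ((1 - ρ / 2)⁻¹) ^ k := by rw [inv_pow]
      _ ≤ (Real.exp ρ) ^ k := pow_le_pow_left₀ (inv_nonneg.mpr hx0.le) h1 k
      _ = Real.exp (ρ * k) := by rw [← Real.exp_nat_mul]; ring_nf
  -- first term: `(1−ρ)^k ≤ e^{−ρk} ≤ e^{ρ}·e^{−ρnh/4} ≤ e·e^{−ρnh/4}`
  have hA : (1 - ρ) ^ k ≤ Real.exp 1 * Real.exp (-(h * ρ / 4) * n) := by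
    refine hpow1.trans ?_
    rw [← Real.exp_add]
    exact Real.exp_le_exp.mpr (by nlinarith [mul_le_mul_of_nonneg_left hk2.le hρ0])
  -- second term: `(1−ρ/2)^{−k} ≤ e^{ρk} ≤ e^{ρnh/4}` and `(1 − hρ/2)^n ≤ e^{−hρn/2}`
  have hB1 : ((1 - ρ / 2) ^ k)⁻¹ ≤ Real.exp (ρ * ((n : ℝ) * h / 4)) :=
    hpow2.trans (Real.exp_le_exp.mpr (mul_le_mul_of_nonneg_left hk1 hρ0))
  have hB2 : (1 - h + h * (1 - ρ / 2)) ^ n ≤ Real.exp (-(h * ρ / 2) * n) := by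
    have e1 : 1 - h + h * (1 - ρ / 2) = 1 - h * ρ / 2 := by ring
    rw [e1]
    have h1 : 1 - h * ρ / 2 ≤ Real.exp (-(h * ρ / 2)) := by have := Real.add_one_le_exp (-(h * ρ / 2)); linarith
    have h0 : 0 ≤ 1 - h * ρ / 2 := by nlinarith [mul_le_one₀ hh1 hρ0 hρ1]
    calc (1 - h * ρ / 2) ^ n ≤ (Real.exp (-(h * ρ / 2))) ^ n := pow_le_pow_left₀ h0 h1 n
      _ = Real.exp (-(h * ρ / 2) * n) := by rw [← Real.exp_nat_mul]; ring_nf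
  have hB : ((1 - ρ / 2) ^ k)⁻¹ * (1 - h + h * (1 - ρ / 2)) ^ n ≤ Real.exp (-(h * ρ / 4) * n) := by
    calc ((1 - ρ / 2) ^ k)⁻¹ * (1 - h + h * (1 - ρ / 2)) ^ n
        ≤ Real.exp (ρ * ((n : ℝ) * h / 4)) * Real.exp (-(h * ρ / 2) * n) :=
          mul_le_mul hB1 hB2 (pow_nonneg (by nlinarith [mul_le_one₀ hh1 hρ0 hρ1]) n) (Real.exp_pos _).le
      _ = Real.exp (-(h * ρ / 4) * n) := by rw [← Real.exp_add]; ring_nf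
  have hE := Real.exp_pos (-(h * ρ / 4) * n)
  nlinarith [mul_le_mul_of_nonneg_right hA hΨ, Real.exp_pos (1 : ℝ)]

variable {X : Type*} [Fintype X] [DecidableEq X] [Nonempty X]

/-- **`d(n) ≤ (e·Ψ_max + 1)·exp(−(hρ/4)·n)`** under the hypotheses of `cyc_worstTvDist_le` and `0 ≤ ρ`. [ours] -/
theorem cyc_worstTvDist_le_exp {P : Matrix X X ℝ} {π : X → ℝ}
    (hπ : IsStationary π P) (hπ0 : ∀ x, 0 ≤ π x) (hπ1 : ∑ x, π x = 1)
    {Q R M : Matrix (X × X) (X × X) ℝ} {h ρ Ψmax : ℝ} {Ψ ind : X × X → ℝ} (hQc : IsMarkovianCoupling P Q)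
    (hQ : Q = h • R + M) (hR0 : ∀ z z', 0 ≤ R z z') (hR1 : ∀ z, ∑ z', R z z' = 1) (hM0 : ∀ z z', 0 ≤ M z z')
    (hM1 : ∀ z, ∑ z', M z z' = 1 - h) (hh0 : 0 ≤ h) (hh1 : h ≤ 1) (hρ0 : 0 ≤ ρ) (hρ1 : ρ ≤ 1)
    (hind : ∀ a b, ind (a, b) = if a = b then 0 else 1)
    (hstick : ∀ z, (Q *ᵥ ind) z ≤ ind z) (hΨ0 : ∀ z, 0 ≤ Ψ z) (hΨmax : ∀ z, Ψ z ≤ Ψmax) (hΨind : ∀ z, (R *ᵥ ind) z ≤ Ψ z)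
    {H : ℕ → X × X → ℝ} (hH0 : H 0 = 0) (hHs : ∀ n, H (n + 1) = h • Ψ + M *ᵥ H n) (hcyc : ∀ n z, (R *ᵥ H n) z ≤ (1 - ρ) * Ψ z)
    (n : ℕ) : worstTvDist P π n ≤ (Real.exp 1 * Ψmax + 1) * Real.exp (-(h * ρ / 4) * n) := by
  have hΨ : 0 ≤ Ψmax := (hΨ0 (Classical.arbitrary _)).trans (hΨmax _)
  have hx0 : 0 < 1 - ρ / 2 := by linarith
  have hx1 : 1 - ρ / 2 ≤ 1 := by linarith
  exact (cyc_worstTvDist_le hπ hπ0 hπ1 hQc hQ hR0 hR1 hM0 hM1 hh0 hh1 hρ1 hind hstick hΨ0 hΨmax hΨind hH0 hHs hcyc n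
    ⌊(n : ℝ) * h / 4⌋₊ hx0 hx1).trans (cyc_bound_le_exp hh0 hh1 hρ0 hρ1 hΨ n)

/-- `C·exp(−a·n) ≤ ε` once `n ≥ (1/a)·log(C/ε)` (`a, ε, C > 0`). [ours] -/
theorem exp_le_of_ge_log {a C ε : ℝ} (ha : 0 < a) (hC : 0 < C) (hε : 0 < ε) {n : ℕ} (hn : 1 / a * Real.log (C / ε) ≤ n) :
    C * Real.exp (-a * n) ≤ ε := by
  have h1 : Real.log (C / ε) ≤ a * n := by
    have := mul_le_mul_of_nonneg_left hn ha.le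
    rwa [← mul_assoc, mul_one_div_cancel ha.ne', one_mul] at this
  have h2 : C / ε ≤ Real.exp (a * n) := by
    calc C / ε = Real.exp (Real.log (C / ε)) := (Real.exp_log (div_pos hC hε)).symm
      _ ≤ Real.exp (a * n) := Real.exp_le_exp.mpr h1
  have h3 : Real.exp (-a * n) = (Real.exp (a * n))⁻¹ := by rw [← Real.exp_neg]; ring_nf
  rw [h3, ← div_eq_mul_inv, div_le_iff₀ (Real.exp_pos _)]
  calc C = C / ε * ε := by field_simp
    _ ≤ Real.exp (a * n) * ε := mul_le_mul_of_nonneg_right h2 hε.le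
    _ = ε * Real.exp (a * n) := mul_comm _ _

/-- **`t_mix(ε) ≤ ⌈(4/(hρ))·log((e·Ψ_max + 1)/ε)⌉₊`** under the hypotheses of `cyc_worstTvDist_le`, `0 < h`, `0 < ρ ≤ 1`, `0 < ε`. [ours] -/
theorem cyc_mixingTime_le {P : Matrix X X ℝ} {π : X → ℝ}
    (hπ : IsStationary π P) (hπ0 : ∀ x, 0 ≤ π x) (hπ1 : ∑ x, π x = 1)
    {Q R M : Matrix (X × X) (X × X) ℝ} {h ρ Ψmax : ℝ} {Ψ ind : X × X → ℝ} (hQc : IsMarkovianCoupling P Q)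
    (hQ : Q = h • R + M) (hR0 : ∀ z z', 0 ≤ R z z') (hR1 : ∀ z, ∑ z', R z z' = 1) (hM0 : ∀ z z', 0 ≤ M z z')
    (hM1 : ∀ z, ∑ z', M z z' = 1 - h) (hh0 : 0 < h) (hh1 : h ≤ 1) (hρ0 : 0 < ρ) (hρ1 : ρ ≤ 1)
    (hind : ∀ a b, ind (a, b) = if a = b then 0 else 1)
    (hstick : ∀ z, (Q *ᵥ ind) z ≤ ind z) (hΨ0 : ∀ z, 0 ≤ Ψ z) (hΨmax : ∀ z, Ψ z ≤ Ψmax) (hΨind : ∀ z, (R *ᵥ ind) z ≤ Ψ z)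
    {H : ℕ → X × X → ℝ} (hH0 : H 0 = 0) (hHs : ∀ n, H (n + 1) = h • Ψ + M *ᵥ H n) (hcyc : ∀ n z, (R *ᵥ H n) z ≤ (1 - ρ) * Ψ z)
    {ε : ℝ} (hε : 0 < ε) :
    mixingTime P π ε ≤ ⌈1 / (h * ρ / 4) * Real.log ((Real.exp 1 * Ψmax + 1) / ε)⌉₊ := by
  have hΨ : 0 ≤ Ψmax := (hΨ0 (Classical.arbitrary _)).trans (hΨmax _)
  refine mixingTime_le _ _ ((cyc_worstTvDist_le_exp hπ hπ0 hπ1 hQc hQ hR0 hR1 hM0 hM1 hh0.le hh1 hρ0.le hρ1 hind hstick hΨ0 hΨmax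
    hΨind hH0 hHs hcyc _).trans ?_)
  exact exp_le_of_ge_log (by positivity) (by positivity) hε (Nat.le_ceil _)

end ExpForm

section Certificate
variable (κ : Fin m → Fin K) (φ : Fin m → S ≃ S)

omit [Fintype S] [DecidableEq S] in
/-- Two configurations redrawn at the hub with the same value coincide iff their cold levels coincide. [ours] -/
theorem update_zero_eq_update_zero_iff (x y : Fin (K + 1) → S) (v : S) :
    update x 0 v = update y 0 v ↔ ∀ i : Fin K, x i.succ = y i.succ := by
  constructor
  · intro h i
    have := congrFun h i.succ
    rwa [update_of_ne (Fin.succ_ne_zero i), update_of_ne (Fin.succ_ne_zero i)] at this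
  · intro h
    funext k
    cases k using Fin.cases with
    | zero => rw [update_self, update_self]
    | succ i => rw [update_of_ne (Fin.succ_ne_zero i), update_of_ne (Fin.succ_ne_zero i), h i]

/-- **`R·1{≠} ≤ Ψ`:** under the shared redraw kernel the pair differs afterwards iff some cold level differs, so any `Ψ ≥ 0` with `Ψ ≥ 1` there dominates
`R·1{≠}` (`μ_0` normalised). [ours] -/
theorem starSync_redraw_mulVec_ind_le (hμ1 : ∑ v, μ 0 v = 1)
    {R : (Fin (K + 1) → S) × (Fin (K + 1) → S) → (Fin (K + 1) → S) × (Fin (K + 1) → S) → ℝ}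
    (hR : ∀ a b, R a b = ∑ v : S, μ 0 v * (if b.1 = update a.1 0 v ∧ b.2 = update a.2 0 v then (1 : ℝ) else 0))
    {ind : (Fin (K + 1) → S) × (Fin (K + 1) → S) → ℝ} (hind : ∀ a, ind a = if a.1 = a.2 then 0 else 1)
    {Ψ : (Fin (K + 1) → S) × (Fin (K + 1) → S) → ℝ} (hΨ0 : ∀ a, 0 ≤ Ψ a)
    (hΨ1 : ∀ a : (Fin (K + 1) → S) × (Fin (K + 1) → S), (∃ i : Fin K, a.1 i.succ ≠ a.2 i.succ) → 1 ≤ Ψ a)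
    (a : (Fin (K + 1) → S) × (Fin (K + 1) → S)) : (Matrix.mulVec (fun a b => R a b) ind) a ≤ Ψ a := by
  -- `(R·ind)(a) = Σ_v μ_0(v)·ind(a.1[0↦v], a.2[0↦v])`
  have h1 : (Matrix.mulVec (fun a b => R a b) ind) a = ∑ v : S, μ 0 v * ind (update a.1 0 v, update a.2 0 v) := by
    simp only [Matrix.mulVec, dotProduct]
    simp_rw [hR, Finset.sum_mul]
    rw [Finset.sum_comm]
    refine sum_congr rfl fun v _ => ?_
    simp_rw [mul_assoc, ← Finset.mul_sum]
    congr 1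
    rw [Finset.sum_eq_single (update a.1 0 v, update a.2 0 v)]
    · rw [if_pos ⟨rfl, rfl⟩, one_mul]
    · rintro b _ hb
      rw [if_neg, zero_mul]
      rintro ⟨h1, h2⟩
      exact hb (Prod.ext h1 h2)
    · intro h; exact absurd (mem_univ _) h
  rw [h1]
  by_cases hc : ∀ i : Fin K, a.1 i.succ = a.2 i.succ
  · have h2 : ∀ v, ind (update a.1 0 v, update a.2 0 v) = 0 := fun v => by
      rw [hind, if_pos ((update_zero_eq_update_zero_iff a.1 a.2 v).mpr hc)]
    simp_rw [h2, mul_zero, sum_const_zero]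
    exact hΨ0 a
  · have h2 : ∀ v, ind (update a.1 0 v, update a.2 0 v) = 1 := fun v => by
      rw [hind, if_neg (fun h => hc ((update_zero_eq_update_zero_iff a.1 a.2 v).mp h))]
    simp_rw [h2, mul_one]
    rw [hμ1]
    obtain ⟨i, hi⟩ := not_forall.mp hc
    exact hΨ1 a ⟨i, hi⟩

/-- **CERTIFICATE ⇒ LAW FOR THE PERSISTENT HUB** (all `K`, all finite `S`, all entry bijections; exact hot redraws, reversible row-stochastic cold kernels).
With `h = (1−t)·w_0`, the synchronous coupling `Q` (`hQ`), its shared redraw kernel `R` (`hR`) and rest `M' = Q − h·R` (`hM'`), the indicator `ind = 1{a.1 ≠ a.2}`,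
a potential `0 ≤ Ψ ≤ Ψ_max` with `Ψ ≥ 1` wherever a cold level differs, and the truncated cycle sums `H_0 = 0`, `H_{n+1} = h·Ψ + M'·H_n`: **if `R·H_n ≤ (1−ρ)·Ψ`
for all `n` (`ρ ≤ 1`), then `d(n) ≤ (1−ρ)^k·Ψ_max + x^{−k}·(1−h+h·x)ⁿ` for all `n, k`, `0 < x ≤ 1`.** [ours] -/
theorem starCycle_worstTvDist_le_of_certificate [Nonempty S] (hm : 1 ≤ m) (ht0 : 0 ≤ t) (ht1 : t ≤ 1) (hw0 : ∀ k, 0 ≤ w k) (hw1 : ∑ k, w k = 1)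
    (hμ : ∀ k x, 0 < μ k x) (hμ1 : ∀ k, ∑ u, μ k u = 1) (hM : ∀ k, IsRowStochastic (M k))
    (hMrev : ∀ k, DetailedBalance (μ k) (M k)) (hM0 : ∀ u v, M 0 u v = μ 0 v)
    {α : Fin m → (Fin (K + 1) → S) → ℝ}
    (hα : ∀ r z, α r z = min 1 (tensorFun μ (edgeFlowSwap (φ r) 0 (κ r).succ z) / tensorFun μ z))
    {Q : (Fin (K + 1) → S) × (Fin (K + 1) → S) → (Fin (K + 1) → S) × (Fin (K + 1) → S) → ℝ}
    (hQ : ∀ a b, Q a b =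
      ∑ r : Fin m, t / m *
        (min (α r a.1) (α r a.2) * (if b.1 = edgeFlowSwap (φ r) 0 (κ r).succ a.1
              ∧ b.2 = edgeFlowSwap (φ r) 0 (κ r).succ a.2 then (1 : ℝ) else 0)
          + (α r a.1 - min (α r a.1) (α r a.2)) * (if b.1 = edgeFlowSwap (φ r) 0 (κ r).succ a.1 ∧ b.2 = a.2
              then (1 : ℝ) else 0)
          + (α r a.2 - min (α r a.1) (α r a.2)) * (if b.1 = a.1 ∧ b.2 = edgeFlowSwap (φ r) 0 (κ r).succ a.2
              then (1 : ℝ) else 0)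
          + (1 - α r a.1 - α r a.2 + min (α r a.1) (α r a.2)) * (if b.1 = a.1 ∧ b.2 = a.2 then (1 : ℝ) else 0))
      + (1 - t) * ∑ k : Fin (K + 1), w k *
        (if a.1 k = a.2 k ∨ k = 0 then
            ∑ v : S, M k (a.1 k) v * (if b.1 = update a.1 k v ∧ b.2 = update a.2 k v then (1 : ℝ) else 0)
          else coordKernel M k a.1 b.1 * coordKernel M k a.2 b.2))
    {R : (Fin (K + 1) → S) × (Fin (K + 1) → S) → (Fin (K + 1) → S) × (Fin (K + 1) → S) → ℝ}
    (hR : ∀ a b, R a b = ∑ v : S, μ 0 v * (if b.1 = update a.1 0 v ∧ b.2 = update a.2 0 v then (1 : ℝ) else 0))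
    {M' : (Fin (K + 1) → S) × (Fin (K + 1) → S) → (Fin (K + 1) → S) × (Fin (K + 1) → S) → ℝ}
    (hM' : ∀ a b, M' a b = Q a b - (1 - t) * w 0 * R a b)
    {ind : (Fin (K + 1) → S) × (Fin (K + 1) → S) → ℝ} (hind : ∀ a, ind a = if a.1 = a.2 then 0 else 1)
    {Ψ : (Fin (K + 1) → S) × (Fin (K + 1) → S) → ℝ} {Ψmax ρ : ℝ} (hΨ0 : ∀ a, 0 ≤ Ψ a) (hΨmax : ∀ a, Ψ a ≤ Ψmax)
    (hΨ1 : ∀ a : (Fin (K + 1) → S) × (Fin (K + 1) → S), (∃ i : Fin K, a.1 i.succ ≠ a.2 i.succ) → 1 ≤ Ψ a) (hρ1 : ρ ≤ 1)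
    {H : ℕ → (Fin (K + 1) → S) × (Fin (K + 1) → S) → ℝ} (hH0 : H 0 = 0)
    (hHs : ∀ n, H (n + 1) = ((1 - t) * w 0) • Ψ + Matrix.mulVec (fun a b => M' a b) (H n))
    (hcyc : ∀ n a, (Matrix.mulVec (fun a b => R a b) (H n)) a ≤ (1 - ρ) * Ψ a)
    (n k : ℕ) {x : ℝ} (hx0 : 0 < x) (hx1 : x ≤ 1) :
    worstTvDist (fun y z : Fin (K + 1) → S =>
        t * ptGraphSwap μ (fun r : Fin m => (((0 : Fin (K + 1)), (κ r).succ) : Fin (K + 1) × Fin (K + 1))) φ y z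
          + (1 - t) * prodKernel w M y z) (tensorFun μ) n
      ≤ (1 - ρ) ^ k * Ψmax + (x ^ k)⁻¹ * (1 - (1 - t) * w 0 + (1 - t) * w 0 * x) ^ n := by
  have hst := dominatedStar_isStationary κ φ (w := w) (M := M) ht0 ht1 hw0 hw1 hμ hM hMrev
  have hP : IsRowStochastic (fun y z : Fin (K + 1) → S =>
      t * ptGraphSwap μ (fun r : Fin m => (((0 : Fin (K + 1)), (κ r).succ) : Fin (K + 1) × Fin (K + 1))) φ y z
        + (1 - t) * prodKernel w M y z) :=
    weightedScheme_isRowStochastic (ptGraphSwap_isRowStochastic hμ) hM hw0 hw1 ht0 ht1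
  have hQc := starSync_isMarkovianCoupling κ φ hm ht0 ht1 hw0 hμ hM hM0 hα hQ
  have hQs : IsRowStochastic Q := hQc.isRowStochastic hP
  have hzero := starSync_offDiag_zero_of_eq κ φ (t := t) (w := w) (M := M) hQ
  obtain ⟨hM'0, hM'1, hdec⟩ := starSync_rest κ φ ht1 hw0 hμ (hμ1 0) hM hM0 ht0 hα hQ hQs hR hM'
  have hRst := starSync_redraw_isRowStochastic (fun v => (hμ 0 v).le) (hμ1 0) hR
  have hw01 : w 0 ≤ 1 := by
    calc w 0 ≤ ∑ k, w k := Finset.single_le_sum (fun k _ => hw0 k) (mem_univ 0)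
      _ = 1 := hw1
  have hh0 : 0 ≤ (1 - t) * w 0 := mul_nonneg (by linarith) (hw0 0)
  have hh1 : (1 - t) * w 0 ≤ 1 := by nlinarith [hw0 0]
  have hind2 : ∀ a b : Fin (K + 1) → S, ind (a, b) = if a = b then 0 else 1 := fun a b => hind (a, b)
  have hstick : ∀ z, (Matrix.mulVec (fun a b => Q a b) ind) z ≤ ind z := fun z => starSync_sticky hQs hzero hind z
  have hΨind := starSync_redraw_mulVec_ind_le (hμ1 0) hR hind hΨ0 hΨ1
  exact cyc_worstTvDist_le hst (fun y => (tensorFun_pos hμ y).le) (sum_tensorFun_eq_one μ hμ1) hQc hdec hRst.1 hRst.2 hM'0 hM'1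
    hh0 hh1 hρ1 hind2 hstick hΨ0 hΨmax hΨind hH0 hHs hcyc n k hx0 hx1

/-- **CERTIFICATE ⇒ MIXING TIME FOR THE PERSISTENT HUB** (all `K`, `S`, `φ_r`): the certificate of `starCycle_worstTvDist_le_of_certificate` with `0 < ρ ≤ 1`, `t < 1`,
`w_0 > 0` gives **`t_mix(ε) ≤ ⌈(4/((1−t)·w_0·ρ))·log((e·Ψ_max + 1)/ε)⌉₊`**. [ours] -/
theorem starCycle_mixingTime_le_of_certificate [Nonempty S] (hm : 1 ≤ m) (ht0 : 0 ≤ t) (ht1 : t < 1) (hw0 : ∀ k, 0 ≤ w k) (hw00 : 0 < w 0)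
    (hw1 : ∑ k, w k = 1) (hμ : ∀ k x, 0 < μ k x) (hμ1 : ∀ k, ∑ u, μ k u = 1) (hM : ∀ k, IsRowStochastic (M k))
    (hMrev : ∀ k, DetailedBalance (μ k) (M k)) (hM0 : ∀ u v, M 0 u v = μ 0 v)
    {α : Fin m → (Fin (K + 1) → S) → ℝ}
    (hα : ∀ r z, α r z = min 1 (tensorFun μ (edgeFlowSwap (φ r) 0 (κ r).succ z) / tensorFun μ z))
    {Q : (Fin (K + 1) → S) × (Fin (K + 1) → S) → (Fin (K + 1) → S) × (Fin (K + 1) → S) → ℝ}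
    (hQ : ∀ a b, Q a b =
      ∑ r : Fin m, t / m *
        (min (α r a.1) (α r a.2) * (if b.1 = edgeFlowSwap (φ r) 0 (κ r).succ a.1
              ∧ b.2 = edgeFlowSwap (φ r) 0 (κ r).succ a.2 then (1 : ℝ) else 0)
          + (α r a.1 - min (α r a.1) (α r a.2)) * (if b.1 = edgeFlowSwap (φ r) 0 (κ r).succ a.1 ∧ b.2 = a.2
              then (1 : ℝ) else 0)
          + (α r a.2 - min (α r a.1) (α r a.2)) * (if b.1 = a.1 ∧ b.2 = edgeFlowSwap (φ r) 0 (κ r).succ a.2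
              then (1 : ℝ) else 0)
          + (1 - α r a.1 - α r a.2 + min (α r a.1) (α r a.2)) * (if b.1 = a.1 ∧ b.2 = a.2 then (1 : ℝ) else 0))
      + (1 - t) * ∑ k : Fin (K + 1), w k *
        (if a.1 k = a.2 k ∨ k = 0 then
            ∑ v : S, M k (a.1 k) v * (if b.1 = update a.1 k v ∧ b.2 = update a.2 k v then (1 : ℝ) else 0)
          else coordKernel M k a.1 b.1 * coordKernel M k a.2 b.2))
    {R : (Fin (K + 1) → S) × (Fin (K + 1) → S) → (Fin (K + 1) → S) × (Fin (K + 1) → S) → ℝ}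
    (hR : ∀ a b, R a b = ∑ v : S, μ 0 v * (if b.1 = update a.1 0 v ∧ b.2 = update a.2 0 v then (1 : ℝ) else 0))
    {M' : (Fin (K + 1) → S) × (Fin (K + 1) → S) → (Fin (K + 1) → S) × (Fin (K + 1) → S) → ℝ}
    (hM' : ∀ a b, M' a b = Q a b - (1 - t) * w 0 * R a b)
    {ind : (Fin (K + 1) → S) × (Fin (K + 1) → S) → ℝ} (hind : ∀ a, ind a = if a.1 = a.2 then 0 else 1)
    {Ψ : (Fin (K + 1) → S) × (Fin (K + 1) → S) → ℝ} {Ψmax ρ : ℝ} (hΨ0 : ∀ a, 0 ≤ Ψ a) (hΨmax : ∀ a, Ψ a ≤ Ψmax)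
    (hΨ1 : ∀ a : (Fin (K + 1) → S) × (Fin (K + 1) → S), (∃ i : Fin K, a.1 i.succ ≠ a.2 i.succ) → 1 ≤ Ψ a) (hρ0 : 0 < ρ) (hρ1 : ρ ≤ 1)
    {H : ℕ → (Fin (K + 1) → S) × (Fin (K + 1) → S) → ℝ} (hH0 : H 0 = 0)
    (hHs : ∀ n, H (n + 1) = ((1 - t) * w 0) • Ψ + Matrix.mulVec (fun a b => M' a b) (H n))
    (hcyc : ∀ n a, (Matrix.mulVec (fun a b => R a b) (H n)) a ≤ (1 - ρ) * Ψ a) {ε : ℝ} (hε : 0 < ε) :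
    mixingTime (fun y z : Fin (K + 1) → S =>
        t * ptGraphSwap μ (fun r : Fin m => (((0 : Fin (K + 1)), (κ r).succ) : Fin (K + 1) × Fin (K + 1))) φ y z
          + (1 - t) * prodKernel w M y z) (tensorFun μ) ε
      ≤ ⌈1 / ((1 - t) * w 0 * ρ / 4) * Real.log ((Real.exp 1 * Ψmax + 1) / ε)⌉₊ := by
  have hst := dominatedStar_isStationary κ φ (w := w) (M := M) ht0 ht1.le hw0 hw1 hμ hM hMrev
  have hP : IsRowStochastic (fun y z : Fin (K + 1) → S =>
      t * ptGraphSwap μ (fun r : Fin m => (((0 : Fin (K + 1)), (κ r).succ) : Fin (K + 1) × Fin (K + 1))) φ y z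
        + (1 - t) * prodKernel w M y z) :=
    weightedScheme_isRowStochastic (ptGraphSwap_isRowStochastic hμ) hM hw0 hw1 ht0 ht1.le
  have hQc := starSync_isMarkovianCoupling κ φ hm ht0 ht1.le hw0 hμ hM hM0 hα hQ
  have hQs : IsRowStochastic Q := hQc.isRowStochastic hP
  have hzero := starSync_offDiag_zero_of_eq κ φ (t := t) (w := w) (M := M) hQ
  obtain ⟨hM'0, hM'1, hdec⟩ := starSync_rest κ φ ht1.le hw0 hμ (hμ1 0) hM hM0 ht0 hα hQ hQs hR hM'
  have hRst := starSync_redraw_isRowStochastic (fun v => (hμ 0 v).le) (hμ1 0) hR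
  have hw01 : w 0 ≤ 1 := by
    calc w 0 ≤ ∑ k, w k := Finset.single_le_sum (fun k _ => hw0 k) (mem_univ 0)
      _ = 1 := hw1
  have hh0 : 0 < (1 - t) * w 0 := mul_pos (by linarith) hw00
  have hh1 : (1 - t) * w 0 ≤ 1 := by nlinarith [hw0 0]
  have hind2 : ∀ a b : Fin (K + 1) → S, ind (a, b) = if a = b then 0 else 1 := fun a b => hind (a, b)
  have hstick : ∀ z, (Matrix.mulVec (fun a b => Q a b) ind) z ≤ ind z := fun z => starSync_sticky hQs hzero hind z
  have hΨind := starSync_redraw_mulVec_ind_le (hμ1 0) hR hind hΨ0 hΨ1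
  exact cyc_mixingTime_le hst (fun y => (tensorFun_pos hμ y).le) (sum_tensorFun_eq_one μ hμ1) hQc hdec hRst.1 hRst.2 hM'0 hM'1
    hh0 hh1 hρ0 hρ1 hind2 hstick hΨ0 hΨmax hΨind hH0 hHs hcyc hε

end Certificate

end Summit.Ventures.LatticeQCDFlow.Scaling

end
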